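import Summits.BirchSwinnertonDyer.Rank1Residual.GaloisImage.KatoCharSumFourierInversion
import Mathlib.NumberTheory.DirichletCharacter.Basic
import Mathlib.RingTheory.IntegralDomain
import HarnessLib

/-!
# Norm elements of the kernels of `(ℤ/n)ˣ → (ℤ/d)ˣ` and the primitive projector: a group-ring element
# vanishing at every "totally primitive" character is killed by `∏_i (#G_i − N_i)`
# (cell `b2b-bsdres`, team n1011, ROUTE-1 PORT anatomy (P-KIM); R1-71 / PK-4b `KatoZetaValueDerivativeCongruence`,
# instantiation file PK-4b-C1 (hypothesis (P) of PK-4b-A `EulerFactorComparison.prod_deriv_mul_sub_eq_sum`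
# in character currency); seat p15 GEN 9)

HONEST FRAMING (cell `b2b-bsdres`, run/shared/lean/b2b/bsd-rank1-residual/, verbatim in every
file): the goal of the cell is to DELETE the COMBINATION-SHAPED residual classes of the
Birch–Swinnerton-Dyer formula for ALL analytic-rank `≤ 1` elliptic curves over `ℚ` — "full BSD
formula for every rank `≤ 1` curve in class `C`" assembled STRICTLY from published theorems — so
that the rank-`≤ 1` remainder becomes exactly the CONSTRUCTION-SHAPED classes, which are TYPED
(missing-input `Prop`s), NOT attempted. This is not "finishing BSD". Team n1011 (N10/N11; ROUTE 1,
the PORT anatomy (P-KIM) of class X4 ∧ `p = 3`): research route on CONSTRUCTION-SHAPED classes;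
prove what is provable now; no claim beyond stated classes; census output = EVIDENCE, never a
Literature fact; RESIDUAL-MAP marks UNCHANGED; nothing is booked by this file. TOOL THEOREMS ONLY:
no definition, no named fact, no instance, no `sorry`.

## What

For `d ∣ n` let `G_d := ker((ℤ/n)ˣ → (ℤ/d)ˣ)` and `N_d := Σ_{g ∈ G_d} δ_g ∈ R[(ℤ/n)ˣ]` its norm
element. §1 (any commutative ring `R`): `δ_g · N_d = N_d` for `g ∈ G_d`, hence `N_d² = #G_d · N_d` and,
for a "derivative" `D = Σ_{j<ν} j·δ_{σ^j}` with `σ ∈ G_d`, `D · N_d = (Σ_{j<ν} j) · N_d` — the relations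
`hNN`/`hDN` of PK-4b-A. §2 (over `ℂ`): Fourier INJECTIVITY on the group ring of `(ℤ/n)ˣ`
(`eq_zero_of_forall_lift_eq_zero`, orthogonality `DirichletCharacter.sum_char_inv_mul_char_eq`), the
value of a character on a norm element (`lift χ N_d = #G_d` if `χ` factors through `d`, `= 0` otherwise:
Mathlib `factorsThrough_iff_ker_unitsMap` + `sum_hom_units_eq_zero`), and the **primitive projector**:
if `lift χ Z = 0` for every character `χ` factoring through NONE of the `d_i` (for `n` squarefree and
`d_i = n/ℓ_i`: every character of conductor `n`), then `(∏_i (#G_{d_i} − N_{d_i})) · Z = 0`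
(`prod_card_sub_norm_mul_eq_zero`) — hypothesis (P) of PK-4b-A in the currency PK-4a delivers.
HONEST LIMITS: pure character theory of `(ℤ/n)ˣ`; nothing about Kato's values or modular elements here.

References: r1 ROUTE-1 §55 R1-71 / D-55-3 (cells/n1011/ROUTE-1.md); K. Rubin, *Euler Systems* §9.6.
-/

noncomputable section

open Finset MonoidAlgebra
open scoped BigOperators

namespace Summit.BirchSwinnertonDyer.Rank1Residual.GaloisImage.EulerFactorComparison

/-! ### §1 Norm elements of subgroups (any commutative ring) -/

section Norm

variable {R : Type*} [CommRing R] {G : Type*} [CommGroup G] [Fintype G] [DecidableEq G]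
variable (H : Subgroup G) [DecidablePred (· ∈ H)]

omit [DecidableEq G] in
/-- `c·δ_g · N_H = c · N_H` for `g ∈ H` (`N_H = Σ_{h ∈ H} δ_h`). [folklore] -/
theorem single_mul_sum_single_subgroup {g : G} (hg : g ∈ H) (c : R) :
    single g c * ∑ h ∈ Finset.univ.filter (· ∈ H), single h (1 : R) =
      c • ∑ h ∈ Finset.univ.filter (· ∈ H), single h (1 : R) := by
  rw [Finset.mul_sum, Finset.smul_sum]
  simp_rw [single_mul_single, mul_one, smul_single, smul_eq_mul, mul_one]
  refine Finset.sum_nbij (fun h => g * h) (fun h hh => ?_) (fun h₁ _ h₂ _ h12 => mul_left_cancel h12)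
    (fun k hk => ?_) (fun _ _ => rfl)
  · rw [Finset.mem_filter] at hh ⊢
    exact ⟨Finset.mem_univ _, H.mul_mem hg hh.2⟩
  · rw [Finset.mem_coe, Finset.mem_filter] at hk
    refine ⟨g⁻¹ * k, ?_, by simp⟩
    rw [Finset.mem_coe, Finset.mem_filter]
    exact ⟨Finset.mem_univ _, H.mul_mem (H.inv_mem hg) hk.2⟩

omit [DecidableEq G] in
/-- `N_H² = #H · N_H` — the relation `hNN` of PK-4b-A with `ν = #H` (a natural number cast into the
group ring). [folklore] -/
theorem sum_single_subgroup_mul_self :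
    (∑ h ∈ Finset.univ.filter (· ∈ H), single h (1 : R)) *
        ∑ h ∈ Finset.univ.filter (· ∈ H), single h (1 : R) =
      (((Finset.univ.filter (· ∈ H)).card : ℕ) : MonoidAlgebra R G) *
        ∑ h ∈ Finset.univ.filter (· ∈ H), single h (1 : R) := by
  rw [Finset.sum_mul]
  rw [Finset.sum_congr rfl fun g hg => single_mul_sum_single_subgroup H (Finset.mem_filter.mp hg).2 1]
  rw [Finset.sum_const, one_smul, nsmul_eq_mul]

omit [DecidableEq G] in
/-- `D · N_H = (Σ_{j<ν} j) · N_H` for the "Kolyvagin derivative" `D = Σ_{j<ν} j·δ_{σ^j}` built on ANY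
`σ ∈ H` — the relation `hDN` of PK-4b-A (`τ = Σ_{j<ν} j = ν(ν−1)/2` cast into the group ring).
[folklore] -/
theorem deriv_mul_sum_single_subgroup {σ : G} (hσ : σ ∈ H) (ν : ℕ) :
    (∑ j ∈ Finset.range ν, single (σ ^ j) ((j : ℕ) : R)) *
        ∑ h ∈ Finset.univ.filter (· ∈ H), single h (1 : R) =
      (((∑ j ∈ Finset.range ν, j : ℕ)) : MonoidAlgebra R G) *
        ∑ h ∈ Finset.univ.filter (· ∈ H), single h (1 : R) := by
  rw [Finset.sum_mul, Nat.cast_sum, Finset.sum_mul]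
  refine Finset.sum_congr rfl fun j _ => ?_
  rw [single_mul_sum_single_subgroup H (H.pow_mem hσ j), ← nsmul_eq_mul, Nat.cast_smul_eq_nsmul]

end Norm

/-! ### §2 Characters of `(ℤ/n)ˣ`: Fourier injectivity, values on norm elements, the projector -/

section Characters

variable (n : ℕ) [NeZero n]

omit [NeZero n] in
/-- The value of a Dirichlet character on a group-ring element, `lift χ Y = Σ_g Y_g χ(g)`, unfolded on
the unit-group character `(Units.coeHom ℂ).comp χ.toUnitHom`. [folklore] -/
theorem lift_single_coeHom (χ : DirichletCharacter ℂ n) (g : (ZMod n)ˣ) (c : ℂ) :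
    MonoidAlgebra.lift ℂ ℂ (ZMod n)ˣ ((Units.coeHom ℂ).comp χ.toUnitHom) (single g c) =
      c * χ (g : ZMod n) := by
  rw [lift_single, smul_eq_mul, MonoidHom.comp_apply, Units.coeHom_apply, MulChar.coe_toUnitHom]

/-- **Fourier injectivity on `ℂ[(ℤ/n)ˣ]`**: an element killed by every Dirichlet character is `0`
(orthogonality: `#(ℤ/n)ˣ · Z_g = Σ_χ χ(g)⁻¹ · lift χ Z`). [folklore] -/
theorem eq_zero_of_forall_lift_eq_zero (Z : MonoidAlgebra ℂ (ZMod n)ˣ)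
    (h : ∀ χ : DirichletCharacter ℂ n,
      MonoidAlgebra.lift ℂ ℂ (ZMod n)ˣ ((Units.coeHom ℂ).comp χ.toUnitHom) Z = 0) : Z = 0 := by
  classical
  haveI := CharSum.hasEnoughRootsOfUnity_exponent_units n
  -- expand `Z = Σ_b Z_b δ_b` over the finite group
  have hZsum : Z = ∑ b : (ZMod n)ˣ, single b (Z.coeff b) := by
    conv_lhs => rw [← MonoidAlgebra.sum_coeff_single Z]
    rw [Finsupp.sum_fintype]
    intro b
    simp
  have hφ : (n.totient : ℂ) ≠ 0 := by exact_mod_cast (Nat.totient_pos.mpr (NeZero.pos n)).ne'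
  have horth : ∀ g b : (ZMod n)ˣ, ∑ χ : DirichletCharacter ℂ n, χ⁻¹ (g : ZMod n) * χ (b : ZMod n) =
      if (g : ZMod n) = b then (n.totient : ℂ) else 0 := by
    intro g b
    have h1 := DirichletCharacter.sum_char_inv_mul_char_eq ℂ (Units.isUnit g) (b : ZMod n)
    simp_rw [CharSum.inv_apply_coe_units]
    exact h1
  -- `φ(n) · Z_g = Σ_χ χ⁻¹(g) · lift χ Z = 0` for every `g`
  have hcoeff : ∀ g : (ZMod n)ˣ, Z.coeff g = 0 := by
    intro g
    have key : ∑ χ : DirichletCharacter ℂ n, χ⁻¹ (g : ZMod n) *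
        MonoidAlgebra.lift ℂ ℂ (ZMod n)ˣ ((Units.coeHom ℂ).comp χ.toUnitHom) Z = (n.totient : ℂ) * Z.coeff g := by
      conv_lhs => rw [hZsum]
      simp_rw [map_sum, lift_single_coeHom, Finset.mul_sum]
      rw [Finset.sum_comm]
      have hinner : ∀ b : (ZMod n)ˣ,
          ∑ χ : DirichletCharacter ℂ n, χ⁻¹ (g : ZMod n) * (Z.coeff b * χ (b : ZMod n)) =
            Z.coeff b * (if (g : ZMod n) = b then (n.totient : ℂ) else 0) := by
        intro b
        rw [← horth g b, Finset.mul_sum]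
        exact Finset.sum_congr rfl fun χ _ => by ring
      rw [Finset.sum_congr rfl fun b _ => hinner b]
      rw [Finset.sum_eq_single g]
      · rw [if_pos rfl, mul_comm]
      · intro b _ hbg
        rw [if_neg (fun h => hbg (Units.ext h).symm), mul_zero]
      · intro hg; exact absurd (Finset.mem_univ g) hg
    have hzero : (n.totient : ℂ) * Z.coeff g = 0 := by
      rw [← key]
      exact Finset.sum_eq_zero fun χ _ => by rw [h χ, mul_zero]
    exact (mul_eq_zero.mp hzero).resolve_left hφ
  rw [hZsum]
  exact Finset.sum_eq_zero fun b _ => by rw [hcoeff b, single_zero]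

/-- A character on a norm element, trivial case: if `χ` factors through `d` then
`lift χ N_{G_d} = #G_d`. [folklore] -/
theorem lift_sum_single_ker_of_factorsThrough {d : ℕ} (hd : d ∣ n) (χ : DirichletCharacter ℂ n)
    (hχ : χ.FactorsThrough d) :
    MonoidAlgebra.lift ℂ ℂ (ZMod n)ˣ ((Units.coeHom ℂ).comp χ.toUnitHom)
        (∑ h ∈ Finset.univ.filter (· ∈ (ZMod.unitsMap hd).ker), single h (1 : ℂ)) =
      ((Finset.univ.filter (· ∈ (ZMod.unitsMap hd).ker)).card : ℂ) := by
  classical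
  rw [map_sum]
  have hker := (DirichletCharacter.factorsThrough_iff_ker_unitsMap hd).mp hχ
  rw [Finset.card_eq_sum_ones, Nat.cast_sum]
  refine Finset.sum_congr rfl fun h hh => ?_
  rw [lift_single_coeHom, one_mul, Nat.cast_one]
  have h1 : χ.toUnitHom h = 1 := hker (Finset.mem_filter.mp hh).2
  rw [← MulChar.coe_toUnitHom, h1, Units.val_one]

/-- A character on a norm element, nontrivial case: if `χ` does NOT factor through `d` then
`lift χ N_{G_d} = 0` (a nontrivial character of the finite group `G_d` sums to zero). [folklore] -/
theorem lift_sum_single_ker_of_not_factorsThrough {d : ℕ} (hd : d ∣ n) (χ : DirichletCharacter ℂ n)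
    (hχ : ¬ χ.FactorsThrough d) :
    MonoidAlgebra.lift ℂ ℂ (ZMod n)ˣ ((Units.coeHom ℂ).comp χ.toUnitHom)
        (∑ h ∈ Finset.univ.filter (· ∈ (ZMod.unitsMap hd).ker), single h (1 : ℂ)) = 0 := by
  classical
  rw [DirichletCharacter.factorsThrough_iff_ker_unitsMap hd] at hχ
  -- the restriction of `χ` to the kernel is a nontrivial hom
  set K := (ZMod.unitsMap hd).ker with hK
  set ψ : K →* ℂ := ((Units.coeHom ℂ).comp χ.toUnitHom).comp K.subtype with hψ
  have hψ1 : ψ ≠ 1 := by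
    intro h1
    apply hχ
    intro x hx
    have := DFunLike.congr_fun h1 ⟨x, hx⟩
    rw [hψ, MonoidHom.comp_apply, MonoidHom.comp_apply, Subgroup.coe_subtype, Units.coeHom_apply,
      MonoidHom.one_apply] at this
    rw [MonoidHom.mem_ker]
    exact Units.ext this
  have hsum := sum_hom_units_eq_zero ψ hψ1
  rw [map_sum, Finset.sum_subtype (Finset.univ.filter (· ∈ (ZMod.unitsMap hd).ker))
    (p := fun x => x ∈ K) (fun x => by simp [hK])]
  rw [← hsum]
  refine Finset.sum_congr rfl fun x _ => ?_
  rw [lift_single_coeHom, one_mul]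
  rfl

/-- **The primitive projector kills what the totally primitive characters do not see.** For divisors
`d_i ∣ n` (`i ∈ ι` finite) and `Z ∈ ℂ[(ℤ/n)ˣ]`: if `lift χ Z = 0` for every Dirichlet character `χ`
that factors through NONE of the `d_i`, then `(∏_i (#G_{d_i} − N_{G_{d_i}})) · Z = 0` — Fourier
injectivity, each character killing either `Z` or one factor `#G_{d_i} − N_{d_i}`. (For `n` squarefree
and `d_i = n/ℓ_i` over the primes of `n`: the characters of conductor `n`; hypothesis (P) of PK-4b-A.)
[folklore] -/
theorem prod_card_sub_norm_mul_eq_zero {ι : Type*} (s : Finset ι) (d : ι → ℕ) (hd : ∀ i, d i ∣ n)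
    (Z : MonoidAlgebra ℂ (ZMod n)ˣ)
    (hZ : ∀ χ : DirichletCharacter ℂ n, (∀ i ∈ s, ¬ χ.FactorsThrough (d i)) →
      MonoidAlgebra.lift ℂ ℂ (ZMod n)ˣ ((Units.coeHom ℂ).comp χ.toUnitHom) Z = 0) :
    (∏ i ∈ s, ((((Finset.univ.filter (· ∈ (ZMod.unitsMap (hd i)).ker)).card : ℂ)) • (1 : MonoidAlgebra ℂ (ZMod n)ˣ) -
        ∑ h ∈ Finset.univ.filter (· ∈ (ZMod.unitsMap (hd i)).ker), single h (1 : ℂ))) * Z = 0 := by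
  classical
  refine eq_zero_of_forall_lift_eq_zero n _ fun χ => ?_
  rw [map_mul, map_prod]
  by_cases hχ : ∃ i ∈ s, χ.FactorsThrough (d i)
  · obtain ⟨i, hi, hfac⟩ := hχ
    rw [Finset.prod_eq_zero hi, zero_mul]
    rw [map_sub, map_smul, map_one, lift_sum_single_ker_of_factorsThrough n (hd i) χ hfac, smul_eq_mul,
      mul_one, sub_self]
  · rw [hZ χ (fun i hi hfac => hχ ⟨i, hi, hfac⟩), mul_zero]

end Characters

end Summit.BirchSwinnertonDyer.Rank1Residual.GaloisImage.EulerFactorComparison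

end
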